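import Literature.NumberTheory.LFunctions.WeilExplicitContinuous
import Mathlib
import HarnessLib

/-!
# Young's inequality for the mollifier in `L²`: `∫‖g ⋆ φ_k‖² ≤ ∫‖g‖²` (RH-FREE; PR item (ii) of THETA-ASSIGN §6)

Cell `rh-explicit`, WEIL column, seat handoff-prove-2 gen12.  For `g : ℝ → ℂ` continuous with compact support and the mollifier
`moll k` (`≥ 0`, `∫ = 1`) of `WeilExplicitContinuous`:

  **`integral_norm_sq_weilConv_moll_le : ∫ x, ‖weilConv g (moll k) x‖² ≤ ∫ x, ‖g x‖²`**

(Cauchy–Schwarz against the probability density `‖φ_k(x − ·)‖`, then Tonelli).  This is the step that transports the norm bounds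
`∫‖T⁻‖² ≤ P.A`, `∫‖(T⁻)′‖² ≤ P.B` (D3) to the mollified truncated tails of the PR assembly.  Nothing here bears on the truth of RH.
-/

noncomputable section

set_option linter.dupNamespace false

open Complex Set MeasureTheory Filter Function
open scoped Real Topology

namespace Summit.RiemannHypothesis.RiemannHypothesis.Theorems.WeilColumn.ThetaMellin

open Literature.NumberTheory.LFunctions Literature.NumberTheory.LFunctions.WeilContinuous

variable {g : ℝ → ℂ}

/-- The real mollifier `m_k = ‖φ_k‖` is continuous. -/
theorem continuous_norm_moll (k : ℕ) : Continuous fun y : ℝ ↦ ‖moll k y‖ := (continuous_moll k).norm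

/-- `m_k` vanishes outside `[−1, 1]`. -/
theorem norm_moll_eq_zero {k : ℕ} {y : ℝ} (hy : 1 ≤ |y|) : ‖moll k y‖ = 0 := by
  rw [moll_eq_zero ((bump_rOut_le_one k).trans hy), norm_zero]

/-- `∫ m_k(x − u) du = 1`. -/
theorem integral_norm_moll_sub (k : ℕ) (x : ℝ) : ∫ u, ‖moll k (x - u)‖ = 1 := by
  have h := integral_norm_moll k
  rw [← integral_sub_left_eq_self (fun u ↦ ‖moll k u‖) volume x] at h
  exact h

/-- **Cauchy–Schwarz against the mollifier**: `‖(g ⋆ φ_k)(x)‖² ≤ ∫ ‖g u‖²·‖φ_k(x−u)‖ du` (`g` continuous of compact support). -/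
theorem norm_sq_weilConv_moll_le (hgc : Continuous g) (hgs : HasCompactSupport g) (k : ℕ) (x : ℝ) :
    ‖weilConv g (moll k) x‖ ^ 2 ≤ ∫ u, ‖g u‖ ^ 2 * ‖moll k (x - u)‖ := by
  set m : ℝ → ℝ := fun u ↦ ‖moll k (x - u)‖ with hm
  have hm0 : ∀ u, 0 ≤ m u := fun u ↦ norm_nonneg _
  have hmc : Continuous m := (continuous_norm_moll k).comp (continuous_const.sub continuous_id)
  -- Step 1: `‖(g⋆φ)(x)‖ ≤ ∫ ‖g u‖ m(u)`
  have h1 : ‖weilConv g (moll k) x‖ ≤ ∫ u, ‖g u‖ * m u := by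
    rw [weilConv_apply]
    refine (norm_integral_le_integral_norm _).trans (le_of_eq ?_)
    refine integral_congr_ae (Eventually.of_forall fun u ↦ ?_)
    simp only [norm_mul, hm]
  -- Step 2: Hölder with `p = q = 2` for `F = ‖g‖√m`, `G = √m`
  set F : ℝ → ℝ := fun u ↦ ‖g u‖ * Real.sqrt (m u) with hF
  set G : ℝ → ℝ := fun u ↦ Real.sqrt (m u) with hG
  have hFG : ∀ u, F u * G u = ‖g u‖ * m u := by
    intro u; simp only [hF, hG]; rw [mul_assoc, Real.mul_self_sqrt (hm0 u)]
  have hF2 : ∀ u, F u ^ (2 : ℝ) = ‖g u‖ ^ 2 * m u := by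
    intro u; simp only [hF]; rw [Real.rpow_two, mul_pow, Real.sq_sqrt (hm0 u)]
  have hG2 : ∀ u, G u ^ (2 : ℝ) = m u := by
    intro u; simp only [hG]; rw [Real.rpow_two, Real.sq_sqrt (hm0 u)]
  have hFc : Continuous F := hgc.norm.mul hmc.sqrt
  have hGc : Continuous G := hmc.sqrt
  have hFs : HasCompactSupport F := by
    refine hgs.norm.mul_right
  have hms : HasCompactSupport m := by
    refine HasCompactSupport.of_support_subset_isCompact (isCompact_Icc (a := x - 1) (b := x + 1)) fun u hu ↦ ?_
    rw [Function.mem_support] at hu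
    by_contra h
    rw [mem_Icc, not_and_or, not_le, not_le] at h
    apply hu
    simp only [hm]
    apply norm_moll_eq_zero
    rcases h with h | h
    · rw [abs_of_pos (by linarith)]; linarith
    · rw [abs_of_neg (by linarith)]; linarith
  have hGs : HasCompactSupport G := hms.comp_left Real.sqrt_zero
  have hholder := integral_mul_le_Lp_mul_Lq_of_nonneg (μ := volume) Real.HolderConjugate.two_two
    (Eventually.of_forall fun u ↦ mul_nonneg (norm_nonneg _) (Real.sqrt_nonneg _))
    (Eventually.of_forall fun u ↦ Real.sqrt_nonneg _)
    (hFc.memLp_of_hasCompactSupport hFs) (hGc.memLp_of_hasCompactSupport hGs)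
  have e1 : ∫ a, F a * G a = ∫ u, ‖g u‖ * m u := integral_congr_ae (Eventually.of_forall hFG)
  have e2 : ∫ a, F a ^ (2 : ℝ) = ∫ u, ‖g u‖ ^ 2 * m u := integral_congr_ae (Eventually.of_forall hF2)
  have e3 : ∫ a, G a ^ (2 : ℝ) = ∫ u, m u := integral_congr_ae (Eventually.of_forall hG2)
  have hGint : ∫ u, m u = 1 := integral_norm_moll_sub k x
  rw [e1, e2, e3, hGint, Real.one_rpow, mul_one] at hholder
  -- square
  have hI0 : 0 ≤ ∫ u, ‖g u‖ ^ 2 * m u := integral_nonneg fun u ↦ mul_nonneg (sq_nonneg _) (hm0 u)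
  have h2 : (∫ u, ‖g u‖ * m u) ^ 2 ≤ ∫ u, ‖g u‖ ^ 2 * m u := by
    have hle : ∫ u, ‖g u‖ * m u ≤ (∫ u, ‖g u‖ ^ 2 * m u) ^ (1 / (2 : ℝ)) := hholder
    have h0 : 0 ≤ ∫ u, ‖g u‖ * m u := integral_nonneg fun u ↦ mul_nonneg (norm_nonneg _) (hm0 u)
    calc (∫ u, ‖g u‖ * m u) ^ 2 ≤ ((∫ u, ‖g u‖ ^ 2 * m u) ^ (1 / (2 : ℝ))) ^ 2 := pow_le_pow_left₀ h0 hle 2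
      _ = ∫ u, ‖g u‖ ^ 2 * m u := by
          rw [← Real.rpow_natCast, ← Real.rpow_mul hI0]; norm_num
  calc ‖weilConv g (moll k) x‖ ^ 2 ≤ (∫ u, ‖g u‖ * m u) ^ 2 := pow_le_pow_left₀ (norm_nonneg _) h1 2
    _ ≤ ∫ u, ‖g u‖ ^ 2 * m u := h2

/-- The two-variable majorant `(x,u) ↦ ‖g u‖²·‖φ_k(x−u)‖` is integrable on `ℝ × ℝ` (continuous, compact support). -/
theorem integrable_norm_sq_mul_moll (hgc : Continuous g) (hgs : HasCompactSupport g) (k : ℕ) :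
    Integrable (uncurry fun x u : ℝ ↦ ‖g u‖ ^ 2 * ‖moll k (x - u)‖) (volume.prod volume) := by
  have hcont : Continuous (uncurry fun x u : ℝ ↦ ‖g u‖ ^ 2 * ‖moll k (x - u)‖) :=
    ((hgc.norm.comp continuous_snd).pow 2).mul ((continuous_norm_moll k).comp (continuous_fst.sub continuous_snd))
  obtain ⟨R, hR⟩ := hgs.isCompact.isBounded.subset_closedBall 0
  refine hcont.integrable_of_hasCompactSupport ?_
  refine HasCompactSupport.of_support_subset_isCompact
    ((isCompact_Icc (a := -(R + 1)) (b := R + 1)).prod (isCompact_Icc (a := -R) (b := R))) fun p hp ↦ ?_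
  rw [Function.mem_support] at hp
  obtain ⟨x, u⟩ := p
  simp only [uncurry_apply_pair, ne_eq, mul_eq_zero, not_or] at hp
  have hu : u ∈ Metric.closedBall (0 : ℝ) R := by
    apply hR; apply subset_tsupport; rw [Function.mem_support]
    intro h; exact hp.1 (by rw [h, norm_zero, zero_pow two_ne_zero])
  rw [Metric.mem_closedBall, dist_zero_right, Real.norm_eq_abs, abs_le] at hu
  have hxu : |x - u| < 1 := by
    by_contra h; exact hp.2 (norm_moll_eq_zero (not_lt.1 h))
  rw [abs_lt] at hxu
  exact ⟨⟨by linarith, by linarith⟩, hu.1, hu.2⟩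

/-- **Young's inequality for the mollifier in `L²`**: `∫‖g ⋆ φ_k‖² ≤ ∫‖g‖²` for `g` continuous of compact support. [folklore] -/
theorem integral_norm_sq_weilConv_moll_le (hgc : Continuous g) (hgs : HasCompactSupport g) (k : ℕ) :
    ∫ x, ‖weilConv g (moll k) x‖ ^ 2 ≤ ∫ x, ‖g x‖ ^ 2 := by
  have hprod := integrable_norm_sq_mul_moll hgc hgs k
  -- Tonelli: `∫_x ∫_u ‖g u‖² m(x−u) = ∫_u ‖g u‖² ∫_x m(x−u) = ∫ ‖g‖²`
  have hswap : ∫ x, ∫ u, ‖g u‖ ^ 2 * ‖moll k (x - u)‖ = ∫ u, ‖g u‖ ^ 2 := by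
    rw [integral_integral_swap hprod]
    refine integral_congr_ae (Eventually.of_forall fun u ↦ ?_)
    simp only
    rw [integral_const_mul, integral_sub_right_eq_self (fun x ↦ ‖moll k x‖) u, integral_norm_moll, mul_one]
  rw [← hswap]
  refine integral_mono_of_nonneg (Eventually.of_forall fun x ↦ sq_nonneg _) hprod.integral_prod_left
    (Eventually.of_forall fun x ↦ norm_sq_weilConv_moll_le hgc hgs k x)

end Summit.RiemannHypothesis.RiemannHypothesis.Theorems.WeilColumn.ThetaMellin

end
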